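import Summits.QuantumFields.YangMills.Theorems.BalabanUVNodesN15KingModelCovariantBlockPositivity
import HarnessLib

/-!
# BalabanUVNodes ∕ N15 — THE KING-MODEL RUNG (PART Ϥ-j): EVERY MONOTONE CONTOUR RULE IS A TREE CONTOUR SYSTEM, and KING's NESTED CONTOURS (2.12) AT LEVEL `k` ARE ONE OF THEM —
# `BlockTree.ofAxis`: any selector `j ↦ axis j` with `j_{axis j} ≠ 0` (parent `j − e_{axis j}`, depth `Σ_μ j_μ ≤ (d+1)(L−1)`); the LAST-BOND RULE of [King1986] (2.12)
# `Γ^{(k)}_{y,x} = Γ_{y,x_{k−1}} ∪ Γ_{x_{k−1},x_{k−2}} ∪ ⋯ ∪ Γ_{x_1,x}` («axis = the largest active direction of the finest non-zero base-`L₀` digit of the offset»); hence PART Ϥ-e's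
# `U`-uniform floor holds for KING's OWN block average (2.11)–(2.12) at every level `k` and every unitary link field
# (Track A, DAG node N15 = NE2; FAN-OUT v1.1 §N15 s3 «KING-MODEL RUNG … + what the curved case adds»; count-neutral)

HONEST FRAMING.  Count-neutral (cell `pub-ymgap`, seat `pub-ymgap-dag-n15-e` g49; `--supports stmt-QuantumFields-27247 --as helper` = K3ᴬ, KEY MAP v3).  King's comparison model.  A tree
contour system (PART Ϥ-b) is determined by the LAST BOND of each contour; for a monotone rule the contour to `j` is a lattice path from the corner with `Σ_μ j_μ` bonds.  King's nested
contour ([King1986] (2.12) p.653: «writing `x_j` as the site for which `x ∈ B^j(x_j)`, we have `Γ^{(k)}_{y,x} = Γ_{y,x_{k−1}} ∪ Γ_{x_{k−1},x_{k−2}} ∪ … ∪ Γ_{x_1,x}` and the contour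
`Γ_{z,w}` is a union of bonds … `[z, z+(w−z)_1e_1] ∪ [z+(w−z)_1e_1, z+(w−z)_1e_1+(w−z)_2e_2] ∪ …`») enters `x = site b j` through its last bond: if `i₀` is the finest level at which `j` is
not a corner (the least `i` with a non-zero base-`L₀` digit `i` of `j`, equivalently the largest `i` with `L₀^i ∣ j_μ` for all `μ`), the last piece `Γ_{x_{i₀+1},x_{i₀}}` is a straight comb
on the fine lattice whose last bond runs along the LARGEST `μ` with digit `i₀` of `j_μ` non-zero, i.e. with `L₀^{i₀+1} ∤ j_μ`.  This file types that rule (`kingNestedAxis`, total for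
every `L`, falling back to the comb where the digit reading is void) and the resulting tree (`kingNested`); that the whole contour of `kingNested` from the corner to `x` IS King's
`Γ^{(k)}_{y,x}` (prefix-closedness of (2.12) under the corner base points) is recorded here in words and used nowhere: downstream only the tree structure matters.  NOT Bałaban's
multi-level `Q_k(U)` of (3.15) (a product of one-level averages at successive block fields, not a single average along nested contours unless the field is flat); NOT (3.42); NOT a
node discharge (N15 of record untouched); nothing continuum ∕ ℝ⁴ ∕ OS ∕ Clay.

RESULTS: §1 def `BlockTree.ofAxis` (+ `ofAxis_root∕_axis∕_depth∕_parent_of_ne_zero`, `ofAxis_parent_apply`), ★ `ofAxis_depth_le` (`≤ (d+1)(L−1)`), ★★★ **`re_quadForm_fullOpU_ofAxis_ge`** (PART Ϥ-e's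
floor `m² + min(a, c∕(L^{d+1}(d+1)(L−1)))` for EVERY monotone contour rule and EVERY unitary `U`), `kingComb_parent_eq_ofAxis` (the comb is `ofAxis kingCombAxis`); §2 defs `kingNestedLevel L₀ k j`
(`Nat.findGreatest`), `kingNestedAxis L₀ k j`, ★ `kingNestedAxis_spec` (`j_{axis} ≠ 0`), `kingNestedAxis_not_dvd` (in the digit regime the chosen coordinate has a non-zero digit `i₀` and is the
largest such), ★ def **`kingNested L₀ k : BlockTree d L`** (KING's (2.12) last-bond rule), ★★★ **`re_quadForm_fullOpU_kingNested_ge`**, ★★ `posDef_fullOpU_kingNested_massless`, ★★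
`l2_opNorm_fullOpU_kingNested_massless_inv_le` (the `U`-uniform massless full propagator for King's own nested block average, every unitary `U`).
PRIOR TREE ART (by name): Ϥ-a (`RootedTree`), Ϥ-b (`BlockTree`, `kingCombDepth`, `kingCombAxis`, `kingCombAxis_spec`, `kingCombParent_apply`, `kingComb_depth_le`, `eq_zero_of_kingCombDepth_eq_zero`),
Ϥ-d (`fullOpU`, `isHermitian_fullOpU`), Ϥ-e (`treeGap`, `re_quadForm_fullOpU_ge_tree`, `posDef_fullOpU_massless`, `l2_opNorm_fullOpU_massless_inv_le`), Mathlib (`Nat.findGreatest`, `Finset.max'`,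
`Function.update`).  Dedup (rg at filing): basename 0 files; needles `ofAxis|kingNested|kingNestedAxis|kingNestedLevel` 0 files in `Summits/QuantumFields/YangMills` + `Literature/MathematicalPhysics`.
presearch: n/a (definitions following the print).  Locators: [King1986] (2.10)–(2.12) p.653; [Balaban1984PropagatorsI] (1.7) p.18; [Balaban1985BackgroundPropagators] (3.15) p.393, (3.19) p.393, p.395 l.1–3.
0 `sorry`.
-/

noncomputable section
open scoped BigOperators ComplexConjugate ComplexOrder Matrix.Norms.L2Operator
open Finset Matrix

namespace Summit.QuantumFields.YangMills.BalabanUVNodes.N15KingModelRung.CovariantBlock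

open Literature.MathematicalPhysics.QuantumFieldTheory.Balaban1983to89.B5Prop11Plancherel (Tor fine unitVec)
open Summit.QuantumFields.YangMills.BalabanUVNodes.N15KingModelRung.Covariant (fib)

variable {d : ℕ} {L : ℕ} [NeZero L]

/-! ## §1 Monotone contour rules -/

section OfAxis

variable (ax : (Fin (d + 1) → Fin L) → Fin (d + 1)) (hax : ∀ j : Fin (d + 1) → Fin L, j ≠ 0 → j (ax j) ≠ 0)

/-- The parent under a monotone rule: `j − e_{axis j}` (`0 ↦ 0`). [cite: King1986, (2.12) p.653; Balaban1984PropagatorsI, (1.7) p.18] -/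
def axisParent (j : Fin (d + 1) → Fin L) : Fin (d + 1) → Fin L :=
  if j = 0 then 0 else Function.update j (ax j) ⟨(j (ax j) : ℕ) - 1, by omega⟩

include hax in
/-- Coordinates of the parent: `(parent j)_ν = j_ν − [ν = axis j]` for `j ≠ 0`. [folklore] -/
theorem axisParent_apply {j : Fin (d + 1) → Fin L} (hj : j ≠ 0) (ν : Fin (d + 1)) :
    ((axisParent ax j ν : ℕ)) = (j ν : ℕ) - (if ν = ax j then 1 else 0) := by
  have := hax j hj
  simp only [axisParent, hj, if_false]
  by_cases hν : ν = ax j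
  · subst hν; rw [Function.update_self, if_pos rfl]
  · rw [Function.update_of_ne hν, if_neg hν, Nat.sub_zero]

include hax in
/-- One bond less under a monotone rule. [folklore] -/
theorem kingCombDepth_axisParent {j : Fin (d + 1) → Fin L} (hj : j ≠ 0) : kingCombDepth d (axisParent ax j) + 1 = kingCombDepth d j := by
  have hpos : 1 ≤ (j (ax j) : ℕ) := by
    rcases Nat.eq_zero_or_pos (j (ax j) : ℕ) with h | h
    · exact absurd (Fin.ext h) (hax j hj)
    · exact h
  unfold kingCombDepth
  rw [← Finset.add_sum_erase _ _ (Finset.mem_univ (ax j)), ← Finset.add_sum_erase _ (fun μ => (j μ : ℕ)) (Finset.mem_univ (ax j))]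
  have hrest : ∑ μ ∈ univ.erase (ax j), (axisParent ax j μ : ℕ) = ∑ μ ∈ univ.erase (ax j), (j μ : ℕ) :=
    Finset.sum_congr rfl fun μ hμ => by rw [axisParent_apply ax hax hj, if_neg (Finset.ne_of_mem_erase hμ), Nat.sub_zero]
  rw [hrest, axisParent_apply ax hax hj, if_pos rfl]
  omega

/-- ★ **EVERY MONOTONE CONTOUR RULE IS A TREE CONTOUR SYSTEM**: an axis selector with `j_{axis j} ≠ 0` off the corner defines a `BlockTree` (parent `j − e_{axis j}`, depth `Σ_μ j_μ`); the
contour to `j` is a monotone lattice path from the corner whose last bond runs along `axis j`. [cite: King1986, (2.12) p.653; Balaban1984PropagatorsI, (1.7) p.18] -/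
def BlockTree.ofAxis : BlockTree d L where
  root := 0
  parent := axisParent ax
  depth := kingCombDepth d
  depth_root := by simp [kingCombDepth]
  depth_parent := fun j hj => kingCombDepth_axisParent ax hax hj
  eq_root_of_depth_eq_zero := fun j hj => eq_zero_of_kingCombDepth_eq_zero hj
  root_eq := rfl
  axis := ax
  step := fun j hj ν => by
    rw [axisParent_apply ax hax hj]
    by_cases hν : ν = ax j
    · subst hν
      rw [if_pos rfl]
      have hpos : 1 ≤ (j (ax j) : ℕ) := by
        rcases Nat.eq_zero_or_pos (j (ax j) : ℕ) with h | h
        · exact absurd (Fin.ext h) (hax j hj)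
        · exact h
      omega
    · rw [if_neg hν]; rfl

/-- The fields of `ofAxis`, by name. [folklore] -/
@[simp] theorem BlockTree.ofAxis_root : (BlockTree.ofAxis ax hax).root = 0 := rfl
/-- The axis of `ofAxis` is the given selector. [folklore] -/
@[simp] theorem BlockTree.ofAxis_axis : (BlockTree.ofAxis ax hax).axis = ax := rfl
/-- The depth of `ofAxis` is `Σ_μ j_μ`. [folklore] -/
@[simp] theorem BlockTree.ofAxis_depth : (BlockTree.ofAxis ax hax).depth = kingCombDepth d := rfl
/-- The parent of `ofAxis`. [folklore] -/
@[simp] theorem BlockTree.ofAxis_parent : (BlockTree.ofAxis ax hax).parent = axisParent ax := rfl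

/-- ★ MONOTONE CONTOURS ARE SHORT: depth `≤ (d+1)(L−1)` for every monotone rule. [cite: King1986, (2.12) p.653] -/
theorem BlockTree.ofAxis_depth_le (j : Fin (d + 1) → Fin L) : (BlockTree.ofAxis ax hax).depth j ≤ (d + 1) * (L - 1) :=
  kingComb_depth_le j

/-- THE COMB IS A MONOTONE RULE: its parent map is `axisParent kingCombAxis`. [cite: Balaban1984PropagatorsI, (1.7) p.18] -/
theorem kingComb_parent_eq_ofAxis : (kingComb d L).parent = axisParent (kingCombAxis d) := by
  funext j
  by_cases hj : j = 0
  · subst hj; rw [kingComb_parent, kingCombParent_zero]; simp [axisParent]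
  · funext ν
    apply Fin.ext
    rw [kingComb_parent, kingCombParent_apply hj, axisParent_apply (kingCombAxis d) (fun j hj => (kingCombAxis_spec hj).1) hj]

variable (M : Fin (d + 1) → ℕ) [hM : ∀ μ, NeZero (M μ)]
variable {𝕜 : Type*} [RCLike 𝕜] {n : Type*} [Fintype n] [DecidableEq n]

/-- ★★★ **PART Ϥ-e's FLOOR FOR EVERY MONOTONE CONTOUR RULE**: `(m² + min(a, c∕(L^{d+1}(d+1)(L−1))))·Σ_x‖v_x‖² ≤ Re⟨v, A₀(U)v⟩` for the block average along the contours of ANY monotone rule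
and EVERY unitary `U`. [cite: Balaban1985BackgroundPropagators, p.395 l.1–3, (3.19) p.393; King1986, (2.11)–(2.13) p.653] -/
theorem re_quadForm_fullOpU_ofAxis_ge {c : ℝ} (hc : 0 ≤ c) (a m2 : ℝ) {U : Tor (fine L M) × Fin (d + 1) → Matrix n n 𝕜} (hU : ∀ bd, U bd ∈ Matrix.unitaryGroup n 𝕜)
    (v : Tor (fine L M) × n → 𝕜) :
    (m2 + treeGap a c L d ((d + 1) * (L - 1))) * ∑ x, ‖fib (fine L M) v x‖ ^ 2 ≤ RCLike.re (star v ⬝ᵥ (fullOpU (BlockTree.ofAxis ax hax) M a c m2 U *ᵥ v)) :=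
  re_quadForm_fullOpU_ge_tree (BlockTree.ofAxis ax hax) M (BlockTree.ofAxis_depth_le ax hax) hc a m2 hU v

end OfAxis

/-! ## §2 King's nested contours (2.12) at level `k` -/

section Nested

variable (L₀ k : ℕ)

/-- THE FINEST NON-CORNER LEVEL of an offset `j`: the largest `i ≤ k` with `L₀^i ∣ j_μ` for all `μ` (`j` is a corner of the level-`i` blocks but — unless `j = 0` — not of level
`i+1`). [cite: King1986, (2.12) p.653] -/
def kingNestedLevel (j : Fin (d + 1) → Fin L) : ℕ := Nat.findGreatest (fun i => ∀ μ, L₀ ^ i ∣ (j μ : ℕ)) k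

/-- ★ KING's NESTED LAST-BOND RULE ((2.12)): the axis of the last bond of `Γ^{(k)}_{y,x}` into `x = site b j` — the LARGEST direction `μ` whose base-`L₀` digit at the finest non-corner level is
non-zero (`L₀^{i₀+1} ∤ j_μ`); where that reading is void (only off the regime `L = L₀^k`) the comb axis. [cite: King1986, (2.12) p.653; Balaban1984PropagatorsI, (1.7) p.18] -/
def kingNestedAxis (j : Fin (d + 1) → Fin L) : Fin (d + 1) :=
  if h : (univ.filter fun μ => ¬ L₀ ^ (kingNestedLevel L₀ k j + 1) ∣ (j μ : ℕ)).Nonempty then (univ.filter fun μ => ¬ L₀ ^ (kingNestedLevel L₀ k j + 1) ∣ (j μ : ℕ)).max' h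
  else kingCombAxis d j

/-- In the digit regime the chosen coordinate is not divisible by `L₀^{i₀+1}` and is the largest such. [cite: King1986, (2.12) p.653] -/
theorem kingNestedAxis_not_dvd {j : Fin (d + 1) → Fin L} (h : (univ.filter fun μ => ¬ L₀ ^ (kingNestedLevel L₀ k j + 1) ∣ (j μ : ℕ)).Nonempty) :
    ¬ L₀ ^ (kingNestedLevel L₀ k j + 1) ∣ (j (kingNestedAxis (d := d) L₀ k j) : ℕ)
      ∧ ∀ ν, kingNestedAxis (d := d) L₀ k j < ν → L₀ ^ (kingNestedLevel L₀ k j + 1) ∣ (j ν : ℕ) := by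
  have hax : kingNestedAxis (d := d) L₀ k j = (univ.filter fun μ => ¬ L₀ ^ (kingNestedLevel L₀ k j + 1) ∣ (j μ : ℕ)).max' h := by simp [kingNestedAxis, h]
  refine ⟨?_, fun ν hν => ?_⟩
  · have := Finset.max'_mem _ h
    rw [← hax] at this
    simpa using this
  · by_contra hdiv
    have hmem : ν ∈ univ.filter fun μ => ¬ L₀ ^ (kingNestedLevel L₀ k j + 1) ∣ (j μ : ℕ) := by simp [hdiv]
    have := Finset.le_max' _ ν hmem
    rw [← hax] at this
    exact absurd hν (not_lt.mpr this)

/-- ★ THE NESTED RULE IS MONOTONE: `j_{axis j} ≠ 0` for `j ≠ 0` (a coordinate not divisible by a power of `L₀` is non-zero; in the fallback, the comb). [cite: King1986, (2.12) p.653] -/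
theorem kingNestedAxis_spec (j : Fin (d + 1) → Fin L) (hj : j ≠ 0) : j (kingNestedAxis (d := d) L₀ k j) ≠ 0 := by
  by_cases h : (univ.filter fun μ => ¬ L₀ ^ (kingNestedLevel L₀ k j + 1) ∣ (j μ : ℕ)).Nonempty
  · intro h0
    have h1 := (kingNestedAxis_not_dvd (d := d) L₀ k h).1
    rw [h0] at h1
    exact h1 (by simp)
  · simp only [kingNestedAxis, h, dif_neg, not_false_eq_true]
    exact (kingCombAxis_spec hj).1

/-- ★ **KING's NESTED CONTOUR SYSTEM (2.12) AT LEVEL `k`** (block side `L`, intended `L = L₀^k`): the tree contour system of the nested last-bond rule.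
[cite: King1986, (2.11)–(2.12) p.653; Balaban1984PropagatorsI, (1.7) p.18] -/
def kingNested : BlockTree d L := BlockTree.ofAxis (L := L) (kingNestedAxis (d := d) (L := L) L₀ k) (kingNestedAxis_spec (d := d) (L := L) L₀ k)

/-- King's nested contours are short: depth `≤ (d+1)(L−1)`. [cite: King1986, (2.12) p.653] -/
theorem kingNested_depth_le (j : Fin (d + 1) → Fin L) : (kingNested (d := d) L₀ k).depth j ≤ (d + 1) * (L - 1) :=
  BlockTree.ofAxis_depth_le _ _ j

/-- In the regime `L = L₀^k`, `L₀ ≥ 1`: for `j ≠ 0` the digit reading is never void (the finest non-corner level is `< k`, so some coordinate has a non-zero digit there) — the nested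
axis is the digit axis, not the comb fallback. [cite: King1986, (2.12) p.653] -/
theorem kingNested_digit_regime (hL : L = L₀ ^ k) {j : Fin (d + 1) → Fin L} (hj : j ≠ 0) :
    (univ.filter fun μ => ¬ L₀ ^ (kingNestedLevel L₀ k j + 1) ∣ (j μ : ℕ)).Nonempty := by
  -- the level is `< k`: not all coordinates are divisible by `L₀^k = L > j_μ` unless `j = 0`
  have hnotk : ¬ (∀ μ, L₀ ^ k ∣ (j μ : ℕ)) := by
    intro h
    apply hj
    funext μ
    have hlt : (j μ : ℕ) < L₀ ^ k := by rw [← hL]; exact (j μ).isLt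
    exact Fin.ext (Nat.eq_zero_of_dvd_of_lt (h μ) hlt)
  have hlevel_lt : kingNestedLevel L₀ k j < k := by
    rcases lt_or_eq_of_le (Nat.findGreatest_le (P := fun i => ∀ μ, L₀ ^ i ∣ (j μ : ℕ)) k) with h | h
    · exact h
    · exfalso
      apply hnotk
      have hk := (Nat.findGreatest_eq_iff.mp h).2.1
      rcases Nat.eq_zero_or_pos k with hk0 | hkpos
      · intro μ; rw [hk0, pow_zero]; exact one_dvd _
      · exact hk hkpos.ne'
  have hfail : ¬ (∀ μ, L₀ ^ (kingNestedLevel L₀ k j + 1) ∣ (j μ : ℕ)) :=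
    Nat.findGreatest_is_greatest (P := fun i => ∀ μ, L₀ ^ i ∣ (j μ : ℕ)) (Nat.lt_succ_self _) hlevel_lt
  push Not at hfail
  obtain ⟨μ, hμ⟩ := hfail
  exact ⟨μ, by simp [hμ]⟩

variable (M : Fin (d + 1) → ℕ) [hM : ∀ μ, NeZero (M μ)]
variable {𝕜 : Type*} [RCLike 𝕜] {n : Type*} [Fintype n] [DecidableEq n]

/-- ★★★ **THE `U`-UNIFORM FLOOR FOR KING's OWN NESTED BLOCK AVERAGE (2.11)–(2.12)**: for every level `k`, base `L₀`, block side `L`, every unitary link field `U`, `c ≥ 0`, every `a`, `m²`: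
`(m² + min(a, c∕(L^{d+1}(d+1)(L−1))))·Σ_x‖v_x‖² ≤ Re⟨v, A₀(U)v⟩` with Bałaban's covariant mean taken along King's nested contours.
[cite: King1986, (2.11)–(2.13) p.653; Balaban1985BackgroundPropagators, (3.19) p.393, p.395 l.1–3] -/
theorem re_quadForm_fullOpU_kingNested_ge {c : ℝ} (hc : 0 ≤ c) (a m2 : ℝ) {U : Tor (fine L M) × Fin (d + 1) → Matrix n n 𝕜} (hU : ∀ bd, U bd ∈ Matrix.unitaryGroup n 𝕜)
    (v : Tor (fine L M) × n → 𝕜) :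
    (m2 + treeGap a c L d ((d + 1) * (L - 1))) * ∑ x, ‖fib (fine L M) v x‖ ^ 2 ≤ RCLike.re (star v ⬝ᵥ (fullOpU (kingNested (d := d) L₀ k) M a c m2 U *ᵥ v)) :=
  re_quadForm_fullOpU_ofAxis_ge _ _ M hc a m2 hU v

/-- ★★ THE MASSLESS FULL OPERATOR WITH KING's NESTED AVERAGE IS POSITIVE DEFINITE AT EVERY UNITARY `U` (`a, c > 0`, `L ≥ 2`). [cite: King1986, (2.13) p.653; Balaban1985BackgroundPropagators, p.395 l.1–3] -/
theorem posDef_fullOpU_kingNested_massless (hL : 2 ≤ L) {a c : ℝ} (ha : 0 < a) (hc : 0 < c) {U : Tor (fine L M) × Fin (d + 1) → Matrix n n 𝕜}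
    (hU : ∀ bd, U bd ∈ Matrix.unitaryGroup n 𝕜) : (fullOpU (kingNested (d := d) L₀ k) M a c 0 U).PosDef :=
  posDef_fullOpU_massless (kingNested (d := d) L₀ k) M (kingNested_depth_le L₀ k) (Nat.mul_pos (Nat.succ_pos d) (by omega)) ha hc hU

/-- ★★ `‖(−cΔ_U + aQ(U)^*Q(U))⁻¹‖ ≤ min(a, c∕(L^{d+1}(d+1)(L−1)))⁻¹` for King's nested average, at every unitary `U` (`a, c > 0`, `L ≥ 2`).
[cite: King1986, (2.13) p.653; Balaban1985BackgroundPropagators, (3.27) p.395, p.395 l.1–3] -/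
theorem l2_opNorm_fullOpU_kingNested_massless_inv_le (hL : 2 ≤ L) {a c : ℝ} (ha : 0 < a) (hc : 0 < c) {U : Tor (fine L M) × Fin (d + 1) → Matrix n n 𝕜}
    (hU : ∀ bd, U bd ∈ Matrix.unitaryGroup n 𝕜) : ‖(fullOpU (kingNested (d := d) L₀ k) M a c 0 U)⁻¹‖ ≤ (treeGap a c L d ((d + 1) * (L - 1)))⁻¹ :=
  l2_opNorm_fullOpU_massless_inv_le (kingNested (d := d) L₀ k) M (kingNested_depth_le L₀ k) (Nat.mul_pos (Nat.succ_pos d) (by omega)) ha hc hU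

end Nested

end Summit.QuantumFields.YangMills.BalabanUVNodes.N15KingModelRung.CovariantBlock

end
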